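import Literature.AlgebraicGeometry.Modules.QuasicoherentAbelian
import Mathlib.CategoryTheory.Preadditive.Biproducts
import HarnessLib

/-!
# Affine-localizing modules: finite biproducts and coproducts with finite support

Sequel of `Modules/AffineLocalizingClosure` and `Modules/QuasicoherentAbelian` (closure of the affine-local property
`IsAffineLocalizing` — numerators and torsion on the principal opens of affine opens, EGA I 1.4.1 d1), d2) ∕ Hartshorne
II Lemma 5.3 — under kernels, cokernels, extensions, isomorphisms, zero objects and FINITE PRODUCTS, Stacks 01LA). Here
the form in which total complexes consume it: the finite biproduct `⨁_j M_j` (`≅ ∏ᶜ_j M_j`), and a coproduct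
`∐_j M_j` over an ARBITRARY index type all of whose summands off a finite set are zero objects (the degree-`n` term of
the total complex of a first-quadrant bicomplex is such a coproduct):

* `IsAffineLocalizing.biproduct` — `⨁_j M_j` for a finite family of affine-localizing modules
  (`(isAffineLocalizing X).prop_product` + `biproduct.isoProduct`);
* `coproductOfFiniteSupportIso` — `∐_{t ∈ T} M_t ≅ ∐_j M_j` when `M_j` is a zero object for `j ∉ T`;
* `IsAffineLocalizing.sigmaObj_of_finite_support` — such a coproduct is affine-localizing.

Everything is proved; no named facts, no instances. Typed for the terms of the total complex `Tot P̌(𝓤, I•)` of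
Stage I of the `D⁺_qc` comparison (cell `pub-hodge-ring2`, a research route conditional on HC_CM, not a corollary;
nothing in this file refers to it).

## References

* The Stacks Project, Tag 01LA (quasi-coherent modules: direct sums, kernels, cokernels, extensions). [StacksProject]
* R. Hartshorne, *Algebraic Geometry*, GTM 52 (1977): II Prop. 5.7 (p. 114). [Hartshorne1977]
-/

noncomputable section

open CategoryTheory CategoryTheory.Limits AlgebraicGeometry TopologicalSpace Opposite

universe w u

namespace Literature.AlgebraicGeometry.Modules

variable {X : Scheme.{u}}

/-! ## Coproducts with finite support -/

/-- **`∐_{t ∈ T} M_t ≅ ∐_j M_j` when `M_j` is a zero object for every `j ∉ T`** (in any category with zero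
morphisms): the inclusion of the partial coproduct, with inverse `ι_j ↦ ι_j` (`j ∈ T`), `0` (`j ∉ T`).
[folklore] -/
def coproductOfFiniteSupportIso {C : Type*} [Category C] [HasZeroMorphisms C] {J : Type w} (f : J → C)
    (T : Finset J) [HasCoproduct f] [HasCoproduct fun t : T => f t] (h0 : ∀ j, j ∉ T → IsZero (f j)) :
    (∐ fun t : T => f t) ≅ ∐ f := by
  classical
  exact
    { hom := Sigma.desc fun t => Sigma.ι f t.1
      inv := Sigma.desc fun j => if h : j ∈ T then Sigma.ι (fun t : T => f t) ⟨j, h⟩ else 0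
      hom_inv_id := Sigma.hom_ext _ _ fun t => by
        rw [Sigma.ι_desc_assoc, Sigma.ι_desc, dif_pos t.2, Category.comp_id]
      inv_hom_id := Sigma.hom_ext _ _ fun j => by
        by_cases h : j ∈ T
        · rw [Sigma.ι_desc_assoc, dif_pos h, Sigma.ι_desc, Category.comp_id]
        · exact (h0 j h).eq_of_src _ _ }

namespace IsAffineLocalizing

/-! ## Finite biproducts -/

/-- **A finite biproduct `⨁_j M_j` of affine-localizing modules is affine-localizing** (Stacks 01LA: finite direct
sums of quasi-coherent modules are quasi-coherent; `⨁_j M_j ≅ ∏ᶜ_j M_j` and `QCoh(X)` is closed under finite products,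
`Modules/QuasicoherentAbelian`). [cite: StacksProject, Tag 01LA] [cite: Hartshorne1977, II Prop. 5.7 (p. 114)] -/
theorem biproduct {J : Type w} [Finite J] (f : J → X.Modules) [HasBiproduct f] [HasProduct f]
    (hf : ∀ j, IsAffineLocalizing (f j)) : IsAffineLocalizing (⨁ f) :=
  of_iso (biproduct.isoProduct f).symm ((isAffineLocalizing X).prop_product (f := f) hf)

/-! ## Coproducts with finite support are affine-localizing -/

/-- **A coproduct `∐_j M_j` whose summands are affine-localizing and zero objects off a finite set `T` is
affine-localizing** (it is the finite direct sum `⨁_{t ∈ T} M_t`). [cite: StacksProject, Tag 01LA]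
[cite: Hartshorne1977, II Prop. 5.7 (p. 114)] -/
theorem sigmaObj_of_finite_support {J : Type w} (f : J → X.Modules) [HasCoproduct f] (T : Finset J)
    [HasCoproduct fun t : T => f t] [HasProduct fun t : T => f t] [HasBiproduct fun t : T => f t]
    (h0 : ∀ j, j ∉ T → IsZero (f j)) (hf : ∀ j ∈ T, IsAffineLocalizing (f j)) : IsAffineLocalizing (∐ f) :=
  of_iso (biproduct.isoCoproduct _ ≪≫ coproductOfFiniteSupportIso f T h0)
    (biproduct (fun t : T => f t) fun t => hf t t.2)

end IsAffineLocalizing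

end Literature.AlgebraicGeometry.Modules

end
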